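import Mathlib
import HarnessLib
import Summits.HubbardSuperconductivity.HubbardSuperconductivity.Theorems.KLProgrammePerturbedFermiCurveTransversalityAlternative
import Summits.HubbardSuperconductivity.HubbardSuperconductivity.Theorems.KLProgrammePerturbedFermiCurveCooperArc

/-!
# Route `KLProgramme` — ENGINE child (stmt-HubbardSuperconductivity-20437 `KLRegimeEngineV17F2`): the translated level function `G(θ) = E(p(θ) − v)` on the frame's
# Fermi curve — its derivative, its `2πℤ²`-periodicity, and the SLOPE LOWER BOUND away from the Cooper point and the caustic (step (T2); frame analogue of
# p1b's `klst_hasDerivAt_transLevel` / `klst_slope_lower_bound`; design note HOME/hubbard-kl-k3c2-p2/TWO-SHELL-FRAME-PORT.md §6)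

Cell `gate-hubbard-kl`, seat hubbard-kl-k3c2-p2 g15.  `E = ε₀ + δ_K` on `Fin 2 → ℝ`, `δ_K = −K.eval`; `p(θ) = u(θ)·dir θ` the canonical polar curve of the level `ν`
(`u = perturbedFermiRadius δ_K ν`); transfer `v`.
* §1 `hasDerivAt_transLevel` — `G′(θ) = ℓ(θ) := 2 sin q₀·X′(θ) + 2 sin q₁·Y′(θ) + Dδ_K(q)[p′(θ)]`, `q = p(θ) − v` (any differentiable radius function `u`);
* §2 `transLevel_sub_int_mul_eq`, `slopeForm_sub_int_mul_eq` — `E` and `ℓ` are unchanged when `q` is moved by `2πm`, `m ∈ ℤ²`; `exists_sub_int_mul_mem_square` — every `q` has a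
  representative in the closed square;
* §3 **`slope_lower_bound_of_geomConstants`** — if `|G(θ) − ν| ≤ η`, the transfer keeps sup-distance `> R₀` from `2πℤ²` (NOT Cooper) and `2p(θ) − v` keeps sup-distance
  `> R₀` from `2πℤ²` (NOT caustic), and `R(λ) ≤ R₀` for the radius `R(·)` of `transversality_alternative_of_geomConstants`, then `λ < |G′(θ)|`.
Everything is PROVED; no definitions, no named facts; nothing asserts any stub or superconductivity.
References: DECOMP App. E Lemma E.1/E.3; FST II App. B [cite: FeldmanSalmhoferTrubowitz1998]; BGM 2006 §2.4, §2.7 [cite: BenfattoGiulianiMastropietro2006].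
-/

noncomputable section

namespace Summit.HubbardSuperconductivity.HubbardSuperconductivity.Theorems.PerturbedFermiCurve

set_option linter.dupNamespace false -- summit = problem name (single-conjunct summit), D-0017

open Real Set
open Literature.MathematicalPhysics.QuantumLattice Literature.MathematicalPhysics.QuantumLattice.BandSectorCounting
open Literature.MathematicalPhysics.QuantumLattice.FermiRG
open Summit.HubbardSuperconductivity.HubbardSuperconductivity.Theorems.DispersionFlow
open Summit.HubbardSuperconductivity.HubbardSuperconductivity.Theorems.KLRegimeSplit

/-! ## §1 The derivative of the translated level function along the curve -/

/-- **`G′(θ) = DE(p(θ) − v)[p′(θ)]` in coordinates**: for a differentiable radius function `u`,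
`d/dθ E(u(θ)dir θ − v) = 2 sin q₀·X_E′ + 2 sin q₁·Y_E′ + Dδ_K(q)[(X_E′, Y_E′)]`, `q = u(θ)dir θ − v`. [folklore] -/
theorem hasDerivAt_transLevel (K : TrigPolyC4v) {u : ℝ → ℝ} (hu : Differentiable ℝ u) (v : Fin 2 → ℝ) (θ : ℝ) :
    HasDerivAt (fun t : ℝ => sqDispersion (u t • dir t - v) + -K.eval (u t • dir t - v))
      (2 * Real.sin ((u θ • dir θ - v) 0) * VXE u θ + 2 * Real.sin ((u θ • dir θ - v) 1) * VYE u θ +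
        fderiv ℝ (fun k : Fin 2 → ℝ => -K.eval k) (u θ • dir θ - v) ![VXE u θ, VYE u θ]) θ := by
  set q := u θ • dir θ - v with hq
  have hcurve : HasDerivAt (fun t : ℝ => u t • dir t - v) ![VXE u θ, VYE u θ] θ :=
    (hasDerivAt_smul_dir_curve (hu θ)).sub_const v
  have hε : DifferentiableAt ℝ sqDispersion q := (contDiff_one_sqDispersion.differentiable (by norm_num)) q
  have hδ : DifferentiableAt ℝ (fun k : Fin 2 → ℝ => -K.eval k) q := (differentiable_frameShift_toLp K) q
  have hE : HasFDerivAt (fun k : Fin 2 → ℝ => sqDispersion k + -K.eval k)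
      (fderiv ℝ sqDispersion q + fderiv ℝ (fun k : Fin 2 → ℝ => -K.eval k) q) q := hε.hasFDerivAt.add hδ.hasFDerivAt
  have h := hE.comp_hasDerivAt θ hcurve
  have e : (fderiv ℝ sqDispersion q + fderiv ℝ (fun k : Fin 2 → ℝ => -K.eval k) q) ![VXE u θ, VYE u θ] =
      2 * Real.sin (q 0) * VXE u θ + 2 * Real.sin (q 1) * VYE u θ + fderiv ℝ (fun k : Fin 2 → ℝ => -K.eval k) q ![VXE u θ, VYE u θ] := by
    rw [add_apply, fderiv_sqDispersion_apply]
    simp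
  rw [e] at h
  exact h

/-! ## §2 Periodicity in `2πℤ²` and reduction to the closed square -/

/-- **`E(q − 2πm) = E(q)`** for `m ∈ ℤ²`. [folklore] -/
theorem transLevel_sub_int_mul_eq (K : TrigPolyC4v) (q : Fin 2 → ℝ) (m : Fin 2 → ℤ) :
    sqDispersion (fun i => q i - m i * (2 * π)) + -K.eval (fun i => q i - m i * (2 * π)) = sqDispersion q + -K.eval q := by
  have h1 : sqDispersion (fun i => q i - m i * (2 * π)) = sqDispersion q := by
    simp only [sqDispersion, Real.cos_sub_int_mul_two_pi]
  have h2 : K.eval (fun i => q i - m i * (2 * π)) = K.eval q := by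
    have h := TrigPolyC4v.eval_periodic K q (fun i => -m i)
    have e : (fun i => q i + ((fun i => -m i) i : ℤ) * (2 * Real.pi)) = fun i => q i - m i * (2 * π) := by
      funext i; push_cast; ring
    rw [e] at h; exact h
  rw [h1, h2]

/-- **The slope form is `2πℤ²`-periodic in the base point**: `2 sin(q₀ − 2πm₀)w₀ + 2 sin(q₁ − 2πm₁)w₁ + Dδ_K(q − 2πm)[w] = 2 sin q₀ w₀ + 2 sin q₁ w₁ + Dδ_K(q)[w]`. [folklore] -/
theorem slopeForm_sub_int_mul_eq (K : TrigPolyC4v) (q w : Fin 2 → ℝ) (m : Fin 2 → ℤ) :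
    2 * Real.sin ((fun i => q i - m i * (2 * π)) 0) * w 0 + 2 * Real.sin ((fun i => q i - m i * (2 * π)) 1) * w 1 +
        fderiv ℝ (fun k : Fin 2 → ℝ => -K.eval k) (fun i => q i - m i * (2 * π)) w =
      2 * Real.sin (q 0) * w 0 + 2 * Real.sin (q 1) * w 1 + fderiv ℝ (fun k : Fin 2 → ℝ => -K.eval k) q w := by
  simp only [Real.sin_sub_int_mul_two_pi]
  -- the derivative of a periodic function is periodic
  set c : Fin 2 → ℝ := fun i => -(m i * (2 * π)) with hc
  have hper : (fun k : Fin 2 → ℝ => -K.eval (k + c)) = fun k : Fin 2 → ℝ => -K.eval k := by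
    funext k
    have h := TrigPolyC4v.eval_periodic K k (fun i => -m i)
    have e : (fun i => k i + ((fun i => -m i) i : ℤ) * (2 * Real.pi)) = k + c := by
      funext i; simp only [hc, Pi.add_apply]; push_cast; ring
    rw [e] at h; rw [h]
  have hq : (fun i => q i - m i * (2 * π)) = q + c := by funext i; simp only [hc, Pi.add_apply]; ring
  have hfd : fderiv ℝ (fun k : Fin 2 → ℝ => -K.eval k) (q + c) = fderiv ℝ (fun k : Fin 2 → ℝ => -K.eval k) q := by
    have h2 : fderiv ℝ (fun x : Fin 2 → ℝ => -K.eval (x + c)) q = fderiv ℝ (fun y : Fin 2 → ℝ => -K.eval y) (q + c) :=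
      fderiv_comp_add_right (f := fun y : Fin 2 → ℝ => -K.eval y) c
    rw [← h2, hper]
  rw [hq, hfd]

/-- **Every point has a representative in the closed square**: `∃ m ∈ ℤ², |q_i − 2πm_i| ≤ π`. [folklore] -/
theorem exists_sub_int_mul_mem_square (q : Fin 2 → ℝ) : ∃ m : Fin 2 → ℤ, ∀ i, |q i - m i * (2 * π)| ≤ π := by
  choose m hm using fun i => exists_int_abs_sub_le_pi (q i)
  exact ⟨m, hm⟩

/-! ## §3 The slope lower bound away from the Cooper point and the caustic -/

section Frame

variable {a b : ℝ} (B : BandBounds a b) {K : TrigPolyC4v} {κ₀ κ₁ : ℝ}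
  (hδ : ∀ k : Fin 2 → ℝ, (∀ i, |k i| ≤ π) → |(fun k : Fin 2 → ℝ => -K.eval k) k| ≤ κ₀)
  (hκ : ∀ k : Fin 2 → ℝ, (∀ i, |k i| ≤ π) → ‖fderiv ℝ (fun k : Fin 2 → ℝ => -K.eval k) k‖ ≤ κ₁) (hκ₁ : κ₁ < B.Dtmin)
  {μ Kc r₀ g₀ w : ℝ} (hG : GeomConstants (frameLevel μ K) Kc r₀ g₀ w) {ν : ℝ} (hν : |ν - μ| < r₀)
include B hδ hκ hκ₁ hG hν

/-- **Slope lower bound** (see the module docstring): with `p = perturbedFermiRadius δ_K ν`, `q = p(θ) − v`, `|E(q) − ν| ≤ η` (`ν ± (κ₀ + η)` admissible), the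
transfer `v` NOT `R₀`-close to `2πℤ²`, `2p(θ) − v` NOT `R₀`-close to `2πℤ²`, and `R(λ) ≤ R₀` — then `λ < |G′(θ)|`.
[cite: FeldmanSalmhoferTrubowitz1998, App. B] -/
theorem slope_lower_bound_of_geomConstants {v : Fin 2 → ℝ} {η lam R₀ : ℝ} (θ : ℝ)
    (hlev : |sqDispersion (perturbedFermiRadius (fun k : Fin 2 → ℝ => -K.eval k) ν θ • dir θ - v) +
        -K.eval (perturbedFermiRadius (fun k : Fin 2 → ℝ => -K.eval k) ν θ • dir θ - v) - ν| ≤ η)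
    (hlo : a ≤ ν - κ₀ - η) (hhi : ν + κ₀ + η ≤ b)
    (hfar : ∀ m : Fin 2 → ℤ, ∃ i, R₀ < |v i + m i * (2 * π)|)
    (hnc : ∀ m : Fin 2 → ℤ, ∃ i, R₀ < |2 * (perturbedFermiRadius (fun k : Fin 2 → ℝ => -K.eval k) ν θ • dir θ) i - v i - m i * (2 * π)|)
    (hR : (η + B.smax * B.Dtmin *
        ((π / 2 * lam / ((B.Dtmin - κ₁) * B.umin) + π * Kc * η / (B.Dtmin - κ₁) ^ 2) * (4 + κ₁) / (B.umin * w))) / (B.Dtmin - κ₁) ≤ R₀) :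
    lam < |2 * Real.sin ((perturbedFermiRadius (fun k : Fin 2 → ℝ => -K.eval k) ν θ • dir θ - v) 0) *
          VXE (perturbedFermiRadius (fun k : Fin 2 → ℝ => -K.eval k) ν) θ +
        2 * Real.sin ((perturbedFermiRadius (fun k : Fin 2 → ℝ => -K.eval k) ν θ • dir θ - v) 1) *
          VYE (perturbedFermiRadius (fun k : Fin 2 → ℝ => -K.eval k) ν) θ +
        fderiv ℝ (fun k : Fin 2 → ℝ => -K.eval k) (perturbedFermiRadius (fun k : Fin 2 → ℝ => -K.eval k) ν θ • dir θ - v)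
          ![VXE (perturbedFermiRadius (fun k : Fin 2 → ℝ => -K.eval k) ν) θ, VYE (perturbedFermiRadius (fun k : Fin 2 → ℝ => -K.eval k) ν) θ]| := by
  set δ : (Fin 2 → ℝ) → ℝ := fun k : Fin 2 → ℝ => -K.eval k with hδdef
  set u := perturbedFermiRadius δ ν with hudef
  set p : Fin 2 → ℝ := u θ • dir θ with hp
  set q : Fin 2 → ℝ := p - v with hq
  set V : Fin 2 → ℝ := ![VXE u θ, VYE u θ] with hV
  -- reduce `q` to the closed square
  obtain ⟨m, hm⟩ := exists_sub_int_mul_mem_square q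
  set k : Fin 2 → ℝ := fun i => q i - m i * (2 * π) with hk
  have hEk : sqDispersion k + -K.eval k = sqDispersion q + -K.eval q := transLevel_sub_int_mul_eq K q m
  have hℓk : 2 * Real.sin (k 0) * V 0 + 2 * Real.sin (k 1) * V 1 + fderiv ℝ δ k V =
      2 * Real.sin (q 0) * V 0 + 2 * Real.sin (q 1) * V 1 + fderiv ℝ δ q V := slopeForm_sub_int_mul_eq K q V m
  have hV0 : V 0 = VXE u θ := by simp [hV]
  have hV1 : V 1 = VYE u θ := by simp [hV]
  -- positivity of the constants
  have hsq : ∀ i, |k i| ≤ π := hm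
  have hκ₁0 : 0 ≤ κ₁ := le_trans (norm_nonneg _) (hκ k hsq)
  have hD : 0 < B.Dtmin - κ₁ := sub_pos.2 hκ₁
  have hum := B.umin_pos
  have hw := hG.wmin_pos
  have hsm := B.smax_pos
  have hDt := B.Dtmin_pos
  have hKc : 0 ≤ Kc := le_trans (norm_nonneg _) (hG.norm_iteratedFDeriv_le (WithLp.toLp 2 k) 0 (by norm_num))
  have hη : 0 ≤ η := (abs_nonneg _).trans hlev
  by_contra hcon
  rw [not_lt] at hcon
  -- the slope at the reduced point is `≤ λ`
  have hℓ : |2 * Real.sin (k 0) * VXE u θ + 2 * Real.sin (k 1) * VYE u θ + fderiv ℝ δ k ![VXE u θ, VYE u θ]| ≤ lam := by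
    have e := hℓk
    rw [hV0, hV1] at e
    rw [e]; exact hcon
  -- the alternative at `k`
  have hshell : |sqDispersion k + -K.eval k - ν| ≤ η := by rw [hEk]; exact hlev
  have halt := transversality_alternative_of_geomConstants B hδ hκ hκ₁ hG hν hsq hshell hlo hhi θ
  -- the radius there is `≤ R₀` (monotone in the slope)
  set τk := (π / 2 * |2 * Real.sin (k 0) * VXE u θ + 2 * Real.sin (k 1) * VYE u θ + fderiv ℝ δ k ![VXE u θ, VYE u θ]| /
      ((B.Dtmin - κ₁) * B.umin) + π * Kc * η / (B.Dtmin - κ₁) ^ 2) * (4 + κ₁) / (B.umin * w) with hτk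
  set τ0 := (π / 2 * lam / ((B.Dtmin - κ₁) * B.umin) + π * Kc * η / (B.Dtmin - κ₁) ^ 2) * (4 + κ₁) / (B.umin * w) with hτ0
  have hτ : τk ≤ τ0 := by
    rw [hτk, hτ0]
    refine div_le_div_of_nonneg_right (mul_le_mul_of_nonneg_right ?_ (by linarith)) (by positivity)
    have := div_le_div_of_nonneg_right (mul_le_mul_of_nonneg_left hℓ (by positivity : (0:ℝ) ≤ π / 2)) (le_of_lt (mul_pos hD hum))
    linarith
  have hRk : (η + B.smax * B.Dtmin * τk) / (B.Dtmin - κ₁) ≤ R₀ := by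
    refine le_trans ?_ hR
    refine div_le_div_of_nonneg_right ?_ hD.le
    have := mul_le_mul_of_nonneg_left hτ (mul_pos hsm hDt).le
    linarith
  have hpπ : u (θ + π) • dir (θ + π) = -p := by
    have heven : ∀ x : Fin 2 → ℝ, δ (-x) = δ x := fun x => by simp [hδdef, TrigPolyC4v.eval_neg]
    rw [hp, hudef]; exact perturbed_point_add_pi heven ν θ
  rcases halt with hC | hS
  · -- Cooper branch contradicts `hfar`
    obtain ⟨i, hi⟩ := hfar m
    have h1 := (hC i).trans hRk
    have e : k i - p i = -(v i + m i * (2 * π)) := by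
      simp only [hk, hq, Pi.sub_apply]; ring
    rw [e, abs_neg] at h1
    exact absurd h1 (not_le.2 hi)
  · -- caustic branch contradicts `hnc`
    obtain ⟨i, hi⟩ := hnc m
    have h1 := (hS i).trans hRk
    rw [hpπ] at h1
    have e : k i - (-p) i = 2 * p i - v i - m i * (2 * π) := by
      simp only [hk, hq, Pi.sub_apply, Pi.neg_apply]; ring
    rw [e] at h1
    exact absurd h1 (not_le.2 hi)

end Frame

end Summit.HubbardSuperconductivity.HubbardSuperconductivity.Theorems.PerturbedFermiCurve

end
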